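import Summits.KontsevichZagierPeriods.KontsevichZagierPeriods.Theorems.UnfoldedStokesStokesGenerationStubPolylogArgHomotopy
import Summits.KontsevichZagierPeriods.KontsevichZagierPeriods.Theorems.UnfoldedStokesStokesGenerationStubLogProductHomotopy
import Summits.KontsevichZagierPeriods.KontsevichZagierPeriods.Theorems.UnfoldedStokesStokesGenerationStubInversionLoopCertificate
import Summits.KontsevichZagierPeriods.KontsevichZagierPeriods.Theorems.UnfoldedStokesStokesGenerationStubLandenLeftovers
import Summits.KontsevichZagierPeriods.KontsevichZagierPeriods.Theorems.UnfoldedStokesStokesGenerationFibrewiseClosureSum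
import Summits.KontsevichZagierPeriods.KontsevichZagierPeriods.Theorems.UnfoldedStokesStokesGenerationFibrewiseRungAngSwap

/-!
# `StokesGeneration` (stmt-KontsevichZagierPeriods-3586), line `fibrewise_stokes` — rung 28: the inversion relation of the
# dilogarithm is constant modulo fibrewise-Stokes decomposability

Crux `Summit.KontsevichZagierPeriods.KontsevichZagierPeriods.Theses.UnfoldedStokes.StokesGeneration`; residual stub S2
(`FibStokesDecomposable`, `Theorems/UnfoldedStokesDefs.lean`). For `x > 0`, `R(x) = Li₂(−x) + Li₂(−1/x) + ½log²x = −π²/6`;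
at a real algebraic `x` the three terms are periods of bounded cube integrands (`−x/(1+xst)`, `−1/(x+st)`,
`½κ(s)κ(t)` with `κ(s) = (x−1)/(1+(x−1)s)`, `∫κ = log x`). This file proves that the difference of these integrands at `x₂`
and `x₁` is fibrewise-Stokes decomposable for all algebraic `x₁, x₂ > 0` (`fibStokesDecomposable_inversion_sub`): the homotopy
`x(v) = x₁ + (x₂−x₁)v` (`stub_polylogArgHomotopy` twice, `stub_logProductHomotopy`) leaves three rational presentations of
logarithms whose sum is the logarithmic derivative of the LOOP `P(s) = (x+s)(1+(x−1)s)/(x(1+xs))`, killed fibrewise in `v` by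
rung 2's loop certificate (`stub_inversionLoopCertificate`), plus two transpositions (rung 12). With duplication (16), Landen
(18), the five-term relation (19) and Euler's reflection (20), all classical functional equations of the real dilogarithm are
in S2's economy modulo constants; the anchor `−π²/6` is not claimed.

References: D. Zagier, *The dilogarithm function* (2007), §I.2; M. Kontsevich, D. Zagier, *Periods* (2001), §1.2.
-/

noncomputable section

-- `Summit.KontsevichZagierPeriods.KontsevichZagierPeriods.…` is the tree's mandated layout (single-conjunct summit).
set_option linter.dupNamespace false

namespace Summit.KontsevichZagierPeriods.KontsevichZagierPeriods.Cruxes.StokesGeneration.FibrewiseStokes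

open MeasureTheory Set
open Literature.NumberTheory.Transcendental
open Literature.NumberTheory.Transcendental.KZ
open Literature.ModelTheory.ExponentialFields (IsSemialgebraic)

/-- The `Li₂(−1/x)` cube integrand in lowest terms. [folklore] -/
theorem inversion_wB_form {x p : ℝ} (hx : x ≠ 0) : -1 / x / (1 - -1 / x * p) = -1 / (x + p) := by
  have e : 1 - -1 / x * p = (x + p) / x := by field_simp; ring
  rw [e, div_div_div_cancel_right₀ hx]

/-- **Rung 28 (lead c6): the inversion relation of the dilogarithm is constant modulo Dec.** For real algebraic
`x₁, x₂ > 0` the difference of the cube integrands on `[0,1]²` of `R(x₂)` and `R(x₁)`,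
`R(x) = Li₂(−x) + Li₂(−1/x) + ½log²x` (`= −π²/6`; `Li₂(−x) ↦ −x/(1+xst)`, `Li₂(−1/x) ↦ −1/(x+st)`,
`log x ↦ ∫₀¹ (x−1)/(1+(x−1)s) ds`), is fibrewise-Stokes decomposable: the homotopy `x(v) = x₁ + (x₂−x₁)v`
(`stub_polylogArgHomotopy` twice, `stub_logProductHomotopy`) leaves `x′·[−1/(1+xs) + 1/(x(x+s)) + (x−1)/(x(1+(x−1)t))]` plus an
antisymmetric term; after one transposition this is `x′/x` times the logarithmic derivative of the loop
`P(s) = (x+s)(1+(x−1)s)/(x(1+xs))`, certified by `stub_inversionLoopCertificate` (rung 2 with a parameter). With Landen (18),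
the five-term relation (19), Euler's reflection (20) and duplication (16): all classical functional equations of `Li₂` modulo
constants are in S2's economy. Transcendence-free and value-free; the anchor `−π²/6` is not claimed.
[cite: Zagier2007Dilogarithm, §I.2] -/
theorem fibStokesDecomposable_inversion_sub (x₁ x₂ : ℝ) (h₁ : IsAlgebraic ℚ x₁) (h₂ : IsAlgebraic ℚ x₂)
    (h₁0 : 0 < x₁) (h₂0 : 0 < x₂) :
    FibStokesDecomposable 2 (fun z =>
      (-x₂ / (1 + x₂ * z 0 * z 1) + -1 / (x₂ + z 0 * z 1) +
          (1 / 2) * (((x₂ - 1) / (1 + (x₂ - 1) * z 0)) * ((x₂ - 1) / (1 + (x₂ - 1) * z 1)))) -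
        (-x₁ / (1 + x₁ * z 0 * z 1) + -1 / (x₁ + z 0 * z 1) +
          (1 / 2) * (((x₁ - 1) / (1 + (x₁ - 1) * z 0)) * ((x₁ - 1) / (1 + (x₁ - 1) * z 1))))) := by
  classical
  have hS1 : IsSemialgebraic ℚ (Set.pi Set.univ (fun _ : Fin 1 => Set.Icc (0:ℝ) 1)) := by
    rw [← cube_eq_pi]; exact isSemialgebraic_cube
  have hS2 : IsSemialgebraic ℚ (Set.pi Set.univ (fun _ : Fin 2 => Set.Icc (0:ℝ) 1)) := by
    rw [← cube_eq_pi]; exact isSemialgebraic_cube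
  have hI : ∀ {z : Fin 1 → ℝ}, z ∈ Set.pi Set.univ (fun _ : Fin 1 => Set.Icc (0:ℝ) 1) → 0 ≤ z 0 ∧ z 0 ≤ 1 :=
    fun hz => (Set.mem_univ_pi.mp hz) 0
  have hI2 : ∀ {z : Fin 2 → ℝ}, z ∈ Set.pi Set.univ (fun _ : Fin 2 => Set.Icc (0:ℝ) 1) → ∀ i, 0 ≤ z i ∧ z i ≤ 1 :=
    fun hz i => (Set.mem_univ_pi.mp hz) i
  have calg : ∀ {t : ℝ}, IsAlgebraic ℚ t → IsSemialgebraicFunOn ℚ (Set.pi Set.univ (fun _ : Fin 1 => Set.Icc (0:ℝ) 1)) (fun _ => t) :=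
    fun ht => isSemialgebraicFunOn_const_of_isAlgebraic hS1 ht
  have calg2 : ∀ {t : ℝ}, IsAlgebraic ℚ t → IsSemialgebraicFunOn ℚ (Set.pi Set.univ (fun _ : Fin 2 => Set.Icc (0:ℝ) 1)) (fun _ => t) :=
    fun ht => isSemialgebraicFunOn_const_of_isAlgebraic hS2 ht
  have z0 : IsSemialgebraicFunOn ℚ (Set.pi Set.univ (fun _ : Fin 1 => Set.Icc (0:ℝ) 1)) (fun z => z 0) := isSemialgebraicFunOn_apply hS1 0
  have y0 : IsSemialgebraicFunOn ℚ (Set.pi Set.univ (fun _ : Fin 2 => Set.Icc (0:ℝ) 1)) (fun z => z 0) := isSemialgebraicFunOn_apply hS2 0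
  have y1 : IsSemialgebraicFunOn ℚ (Set.pi Set.univ (fun _ : Fin 2 => Set.Icc (0:ℝ) 1)) (fun z => z 1) := isSemialgebraicFunOn_apply hS2 1
  set d : ℝ := x₂ - x₁ with hd
  have hdA : IsAlgebraic ℚ d := h₂.sub h₁
  -- the path `x(v) = x₁ + d v` stays positive on `[0,1]`
  have hxI : ∀ v ∈ Set.Icc (0:ℝ) 1, 0 < x₁ + d * v := by
    intro v hv
    rcases le_or_gt 0 d with hd0 | hd0
    · nlinarith [hv.1, hv.2]
    · nlinarith [hv.1, hv.2]
  have sx : IsSemialgebraicFunOn ℚ (Set.pi Set.univ (fun _ : Fin 1 => Set.Icc (0:ℝ) 1)) (fun z => x₁ + d * z 0) :=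
    (calg h₁).fun_add ((calg hdA).fun_mul z0)
  have sxne : ∀ z ∈ Set.pi Set.univ (fun _ : Fin 1 => Set.Icc (0:ℝ) 1), x₁ + d * z 0 ≠ 0 :=
    fun z hz => (hxI _ (hI hz)).ne'
  -- (1) `Li₂(−x(v))`
  have gA := stub_polylogArgHomotopy (fun v => -(x₁ + d * v)) (fun _ => -d) sx.fun_neg (calg hdA).fun_neg
    (by fun_prop) continuousOn_const
    (fun v _ => (((hasDerivAt_id' v).const_mul d).const_add x₁).fun_neg.congr_deriv (by ring))
    (fun v hv => by linarith [hxI v hv])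
  -- (2) `Li₂(−1/x(v))`
  have gB := stub_polylogArgHomotopy (fun v => -1 / (x₁ + d * v)) (fun v => d / (x₁ + d * v) ^ 2)
    ((calg isAlgebraic_one).fun_neg.div sx sxne)
    ((calg hdA).div (sx.fun_pow 2) fun z hz => pow_ne_zero 2 (sxne z hz))
    (ContinuousOn.div (by fun_prop) (by fun_prop) fun v hv => (hxI v hv).ne')
    (ContinuousOn.div (by fun_prop) (by fun_prop) fun v hv => pow_ne_zero 2 (hxI v hv).ne')
    (fun v hv => by
      have hx0 : x₁ + d * v ≠ 0 := (hxI v (Set.Ioo_subset_Icc_self hv)).ne'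
      have hx := ((hasDerivAt_id' v).const_mul d).const_add x₁
      exact ((hasDerivAt_const v (-1 : ℝ)).div hx hx0).congr_deriv (by field_simp; ring))
    (fun v hv => by
      have := hxI v hv
      have : -1 / (x₁ + d * v) < 0 := div_neg_of_neg_of_pos (by norm_num) this
      linarith)
  -- (3) `½log²x(v)`: `ℓ(s,v) = (x−1)/(1+(x−1)s)`, `ℓᵥ = d/(1+(x−1)s)²`, `μ = d s/(1+(x−1)s)`
  have hden : ∀ z ∈ Set.pi Set.univ (fun _ : Fin 2 => Set.Icc (0:ℝ) 1), 0 < 1 + (x₁ + d * z 1 - 1) * z 0 := by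
    intro z hz
    have hx := hxI (z 1) ⟨(hI2 hz 1).1, (hI2 hz 1).2⟩
    have h0 := hI2 hz 0
    nlinarith [mul_nonneg hx.le h0.1, h0.2]
  have sx2 : IsSemialgebraicFunOn ℚ (Set.pi Set.univ (fun _ : Fin 2 => Set.Icc (0:ℝ) 1)) (fun z => x₁ + d * z 1 - 1) :=
    ((calg2 h₁).fun_add ((calg2 hdA).fun_mul y1)).fun_sub (calg2 isAlgebraic_one)
  have sD : IsSemialgebraicFunOn ℚ (Set.pi Set.univ (fun _ : Fin 2 => Set.Icc (0:ℝ) 1)) (fun z => 1 + (x₁ + d * z 1 - 1) * z 0) :=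
    (calg2 isAlgebraic_one).fun_add (sx2.fun_mul y0)
  have gP := stub_logProductHomotopy
    (fun s v => (x₁ + d * v - 1) / (1 + (x₁ + d * v - 1) * s))
    (fun s v => d / (1 + (x₁ + d * v - 1) * s) ^ 2)
    (fun s v => d * s / (1 + (x₁ + d * v - 1) * s))
    (sx2.div sD fun z hz => (hden z hz).ne')
    ((calg2 hdA).div (sD.fun_pow 2) fun z hz => pow_ne_zero 2 (hden z hz).ne')
    (((calg2 hdA).fun_mul y0).div sD fun z hz => (hden z hz).ne')
    (ContinuousOn.div (by fun_prop) (by fun_prop) fun z hz => (hden z hz).ne')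
    (ContinuousOn.div (by fun_prop) (by fun_prop) fun z hz => pow_ne_zero 2 (hden z hz).ne')
    (ContinuousOn.div (by fun_prop) (by fun_prop) fun z hz => (hden z hz).ne')
    (fun s hs v hv => by
      have hne : 1 + (x₁ + d * v - 1) * s ≠ 0 := by
        have := hden ![s, v] (Set.mem_univ_pi.mpr (Fin.forall_fin_two.mpr ⟨hs, Set.Ioo_subset_Icc_self hv⟩))
        simpa using this.ne'
      have hx := (((hasDerivAt_id' v).const_mul d).const_add x₁).sub_const 1
      exact (hx.div ((hx.mul_const s).const_add 1) hne).congr_deriv (by field_simp; ring))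
    (fun v hv s hs => by
      have hne : 1 + (x₁ + d * v - 1) * s ≠ 0 := by
        have := hden ![s, v] (Set.mem_univ_pi.mpr (Fin.forall_fin_two.mpr ⟨Set.Ioo_subset_Icc_self hs, hv⟩))
        simpa using this.ne'
      have hnum := (hasDerivAt_id' s).const_mul d
      have hden' := ((hasDerivAt_id' s).const_mul (x₁ + d * v - 1)).const_add 1
      exact (hnum.fun_div hden' hne).congr_deriv (by field_simp; ring))
    (fun v _ => by simp)
  -- (4) the loop certificate (rung 2 with the parameter `v`), coefficient `γ = d`
  have gH := stub_inversionLoopCertificate x₁ x₂ h₁ h₂ h₁0 h₂0 (fun _ => d) (calg hdA) continuousOn_const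
  -- (5) two transpositions: the `log x/x` presentation and the antisymmetric part of (3)
  obtain ⟨U, hU⟩ : ∃ U : Set (Fin 3 → ℝ), U = {z | 0 < x₁ + d * z 2 ∧ 0 < 1 + (x₁ + d * z 2 - 1) * z 0 ∧
      0 < 1 + (x₁ + d * z 2 - 1) * z 1} := ⟨_, rfl⟩
  have hUo : IsOpen U := by
    have c0 : Continuous fun z : Fin 3 → ℝ => x₁ + d * z 2 := by fun_prop
    have c1 : Continuous fun z : Fin 3 → ℝ => 1 + (x₁ + d * z 2 - 1) * z 0 := by fun_prop
    have c2 : Continuous fun z : Fin 3 → ℝ => 1 + (x₁ + d * z 2 - 1) * z 1 := by fun_prop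
    rw [hU]
    exact (isOpen_lt continuous_const c0).inter ((isOpen_lt continuous_const c1).inter (isOpen_lt continuous_const c2))
  have hUsa : IsSemialgebraic ℚ U := by
    have hV : IsSemialgebraic ℚ (Set.univ : Set (Fin 3 → ℝ)) :=
      Literature.ModelTheory.ExponentialFields.isSemialgebraic_univ
    have ux' : ∀ i, IsSemialgebraicFunOn ℚ (Set.univ : Set (Fin 3 → ℝ)) (fun z => z i) := fun i =>
      isSemialgebraicFunOn_apply hV i
    have uone : IsSemialgebraicFunOn ℚ (Set.univ : Set (Fin 3 → ℝ)) (fun _ => (1:ℝ)) := by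
      simpa using isSemialgebraicFunOn_const_natCast hV 1
    have ux2 := (isSemialgebraicFunOn_const_of_isAlgebraic hV h₁).fun_add
      ((isSemialgebraicFunOn_const_of_isAlgebraic hV hdA).fun_mul (ux' 2))
    have n0 := ux2.fun_neg.isSemialgebraic_sep_neg
    have n1 := (((ux2.fun_sub uone).fun_mul (ux' 0)).fun_add uone).fun_neg.isSemialgebraic_sep_neg
    have n2 := (((ux2.fun_sub uone).fun_mul (ux' 1)).fun_add uone).fun_neg.isSemialgebraic_sep_neg
    rw [hU]
    convert n0.inter (n1.inter n2) using 1
    ext z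
    simp only [Set.mem_setOf_eq, Set.mem_inter_iff, Set.mem_univ, true_and, neg_neg_iff_pos]
    constructor
    · rintro ⟨a, b, c⟩; exact ⟨a, by linarith, by linarith⟩
    · rintro ⟨a, b, c⟩; exact ⟨a, by linarith, by linarith⟩
  have hCU : Set.pi Set.univ (fun _ : Fin 3 => Set.Icc (0:ℝ) 1) ⊆ U := by
    intro z hz
    have hm : ∀ i, z i ∈ Set.Icc (0:ℝ) 1 := fun i => (Set.mem_univ_pi.mp hz) i
    have hx := hxI (z 2) (hm 2)
    rw [hU]
    refine ⟨hx, ?_, ?_⟩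
    · nlinarith [mul_nonneg hx.le (hm 0).1, (hm 0).2]
    · nlinarith [mul_nonneg hx.le (hm 1).1, (hm 1).2]
  have hDx : ∀ z ∈ U, x₁ + d * z 2 ≠ 0 := fun z hz => by rw [hU] at hz; exact hz.1.ne'
  have hD0 : ∀ z ∈ U, 1 + (x₁ + d * z 2 - 1) * z 0 ≠ 0 := fun z hz => by rw [hU] at hz; exact hz.2.1.ne'
  have hD1 : ∀ z ∈ U, 1 + (x₁ + d * z 2 - 1) * z 1 ≠ 0 := fun z hz => by rw [hU] at hz; exact hz.2.2.ne'
  have ux : ∀ i, IsSemialgebraicFunOn ℚ U (fun z => z i) := fun i => isSemialgebraicFunOn_apply hUsa i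
  have uone : IsSemialgebraicFunOn ℚ U (fun _ => (1:ℝ)) := by simpa using isSemialgebraicFunOn_const_natCast hUsa 1
  have uxv : IsSemialgebraicFunOn ℚ U (fun z => x₁ + d * z 2) :=
    (isSemialgebraicFunOn_const_of_isAlgebraic hUsa h₁).fun_add ((isSemialgebraicFunOn_const_of_isAlgebraic hUsa hdA).fun_mul (ux 2))
  have ud : IsSemialgebraicFunOn ℚ U (fun _ => d) := isSemialgebraicFunOn_const_of_isAlgebraic hUsa hdA
  have hhalf : IsAlgebraic ℚ ((1:ℝ) / 2) := by simpa using isAlgebraic_algebraMap (R := ℚ) (A := ℝ) (1 / 2)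
  have hD1sq : ∀ z ∈ U, (1 + (x₁ + d * z 2 - 1) * z 1) ^ 2 ≠ 0 := fun z hz => pow_ne_zero 2 (hD1 z hz)
  have hswap1 := landenLeft_sub_comp_perm_of_contDiffOn U hUo hCU
    (fun z => d / (x₁ + d * z 2) * ((x₁ + d * z 2 - 1) / (1 + (x₁ + d * z 2 - 1) * z 0)))
    ((ud.div uxv hDx).fun_mul ((uxv.fun_sub uone).div (uone.fun_add ((uxv.fun_sub uone).fun_mul (ux 0))) hD0))
    (by fun_prop (disch := assumption)) (Equiv.swap 0 1)
  have hswap2 := landenLeft_sub_comp_perm_of_contDiffOn U hUo hCU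
    (fun z => (1 / 2) * (((x₁ + d * z 2 - 1) / (1 + (x₁ + d * z 2 - 1) * z 0)) *
      (d / (1 + (x₁ + d * z 2 - 1) * z 1) ^ 2)))
    ((isSemialgebraicFunOn_const_of_isAlgebraic hUsa hhalf).fun_mul
      (((uxv.fun_sub uone).div (uone.fun_add ((uxv.fun_sub uone).fun_mul (ux 0))) hD0).fun_mul
        (ud.div ((uone.fun_add ((uxv.fun_sub uone).fun_mul (ux 1))).fun_pow 2) hD1sq)))
    (by fun_prop (disch := assumption)) (Equiv.swap 0 1)
  -- (6) sum up and un-pad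
  have hS := fibStokesDecomposable_sub 3 _ _
    (fibStokesDecomposable_add 3 _ _ (fibStokesDecomposable_sub 3 _ _ gH hswap1) hswap2)
    (fibStokesDecomposable_add 3 _ _ (fibStokesDecomposable_add 3 _ _ gA gB) gP)
  have hle : 2 ≤ 3 := by norm_num
  refine fibStokesDecomposable_unpad hle _ (fibStokesDecomposable_congr_off_null 3 _ _ ∅
    Literature.ModelTheory.ExponentialFields.isSemialgebraic_empty measure_empty (fun z hz _ => ?_) hS)
  have hzU : z ∈ U := hCU hz
  rw [hU] at hzU
  obtain ⟨dx, d0, d1⟩ := hzU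
  have hm : ∀ i, z i ∈ Set.Icc (0:ℝ) 1 := fun i => (Set.mem_univ_pi.mp hz) i
  have e0 : z (Fin.castLE hle 0) = z 0 := rfl
  have e1 : z (Fin.castLE hle 1) = z 1 := rfl
  have hne20 : (2 : Fin 3) ≠ 0 := by decide
  have hne21 : (2 : Fin 3) ≠ 1 := by decide
  have e6 : x₁ + d = x₂ := by rw [hd]; ring
  simp only [e0, e1, Equiv.swap_apply_left, Equiv.swap_apply_right, Equiv.swap_apply_of_ne_of_ne hne20 hne21,
    mul_one, mul_zero, add_zero, e6]
  rw [hd] at dx d0 d1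
  rw [hd]
  set X : ℝ := x₁ + (x₂ - x₁) * z 2 with hXdef
  have hX : X ≠ 0 := dx.ne'
  have hXz : X + z 0 ≠ 0 := by have := (hm 0).1; intro h; linarith [dx]
  have hd0' : 1 + (X - 1) * z 0 ≠ 0 := d0.ne'
  have hd1' : 1 + (X - 1) * z 1 ≠ 0 := d1.ne'
  have hw : 1 - -1 / X * z 0 = (X + z 0) / X := by field_simp; ring
  have hp2 : 1 + x₂ * z 0 * z 1 ≠ 0 := by
    have := mul_nonneg (mul_nonneg h₂0.le (hm 0).1) (hm 1).1; intro h; linarith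
  have hp1 : 1 + x₁ * z 0 * z 1 ≠ 0 := by
    have := mul_nonneg (mul_nonneg h₁0.le (hm 0).1) (hm 1).1; intro h; linarith
  have hq2 : x₂ + z 0 * z 1 ≠ 0 := by
    have := mul_nonneg (hm 0).1 (hm 1).1; intro h; linarith
  have hq1 : x₁ + z 0 * z 1 ≠ 0 := by
    have := mul_nonneg (hm 0).1 (hm 1).1; intro h; linarith
  have hr2 : 1 + (x₂ - 1) * z 0 ≠ 0 := by nlinarith [mul_nonneg h₂0.le (hm 0).1, (hm 0).2]
  have hr2' : 1 + (x₂ - 1) * z 1 ≠ 0 := by nlinarith [mul_nonneg h₂0.le (hm 1).1, (hm 1).2]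
  have hr1 : 1 + (x₁ - 1) * z 0 ≠ 0 := by nlinarith [mul_nonneg h₁0.le (hm 0).1, (hm 0).2]
  have hr1' : 1 + (x₁ - 1) * z 1 ≠ 0 := by nlinarith [mul_nonneg h₁0.le (hm 1).1, (hm 1).2]
  have hXp : 1 + X * z 0 ≠ 0 := by have := mul_nonneg dx.le (hm 0).1; intro h; linarith
  have h1X : 1 + (X - 1) ≠ 0 := by intro h; apply hX; linarith
  rw [mul_assoc (-x₂) (z 0) (z 1), mul_assoc (-x₁) (z 0) (z 1), mul_assoc (-1 / x₂) (z 0) (z 1),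
    mul_assoc (-1 / x₁) (z 0) (z 1), inversion_wB_form (p := z 0 * z 1) h₂0.ne',
    inversion_wB_form (p := z 0 * z 1) h₁0.ne', hw]
  have i1 : -x₂ / (1 - -x₂ * (z 0 * z 1)) = -x₂ / (1 + x₂ * z 0 * z 1) := by ring_nf
  have i2 : -x₁ / (1 - -x₁ * (z 0 * z 1)) = -x₁ / (1 + x₁ * z 0 * z 1) := by ring_nf
  have i3 : -(x₂ - x₁) / (1 - -X * z 0) = -(x₂ - x₁) / (1 + X * z 0) := by ring_nf
  have i4 : (x₂ - x₁) / X ^ 2 / ((X + z 0) / X) = (x₂ - x₁) / (X * (X + z 0)) := by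
    field_simp
  rw [i1, i2, i3, i4]
  -- freeze the denominators and clear the few remaining divisions
  generalize hP0 : 1 + (X - 1) * z 0 = P0 at hd0' ⊢
  generalize hP1 : 1 + (X - 1) * z 1 = P1 at hd1' ⊢
  generalize hQ : X * (X + z 0) = Q
  have hQ' : Q ≠ 0 := by rw [← hQ]; exact mul_ne_zero hX hXz
  generalize hR : 1 + X * z 0 = R at hXp ⊢
  field_simp
  ring

end Summit.KontsevichZagierPeriods.KontsevichZagierPeriods.Cruxes.StokesGeneration.FibrewiseStokes

end
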